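import Summits.Ventures.QEC.Census.CSSK1SplitMacWilliams
import Summits.Ventures.QEC.Census.CSSLPCertificate
import Literature.InformationTheory.Coding.PerfectCodeWeightRecurrence
import HarnessLib

/-!
# The split linear program of the `k = 1` CSS normal form, and its Farkas soundness

LADDER-QEC (venture cell `qec`), type-10 lane (certificate checker + soundness), for the cell `(16, 1)` of the optimal-CSS table
(census/type-02/css161) and every other `k = 1` CSS cell. qec-type-02's `Census/CSSNormalFormK1.lean` (`exists_normalForm`) reduces a
CSS code with `k = 1` to a pair `(A, s)`, `A ∈ 𝔽₂^{κ × μ}` (`|κ| = rank H^Z`), `s ∈ 𝔽₂^μ ∖ 0`, with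
`(Z) ∀ v, d^Z ≤ wt v + wt(vA + s)` and `(X) ∀ u, ⟨u, s⟩ = 1 → d^X ≤ wt u + wt(Au)`. THIS FILE: with `S = supp s` (`w = |S|`,
`c = |μ| − w`) the SPLIT weight distribution `α_{(i,j,l)} = #{v : wt v = i, wt_S(vA) = j, wt_{Sᶜ}(vA) = l}` of the `Z`-stabilizer code
`{(v, vA)}` is a feasible point of the linear system `k1Rows b w c d mw` (`lpFeasible_k1Rows`):
* `α_{(0,0,0)} = 1`; `α_t = 0` for the EXCLUDED types (`zeroTriples`): `i = 0, t ≠ 0` (only `v = 0` has weight `0`) and, by `(Z)`,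
  every `t = (i,j,l)` with `i ≥ 1` and `i + (w − j) + l ≤ d − 1` (the `Z`-logical `(v, vA + 1_S)` has exactly that weight);
* the information-block rows `Σ_{j,l} α_{(i,j,l)} = C(b, i)` (`rowP1`: every `v` of weight `i` occurs once);
* for each listed dual type `t = (i,j,l)` the split-MacWilliams row (`rowMW`, `Census/CSSK1SplitMacWilliams.lean`):
  `Σ_{t'} K_i(i')K_j(j')K_l(l') α_{t'} = 2^b · #{u : dual type t} ≥ 0`, with EQUALITY `= 0` when `j` is odd and `i + j + l ≤ d − 1`
  (`xcCond`; by `(X)`: such a `u` has `⟨u, s⟩ = 1` and is an `X`-logical of weight `i + j + l`).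
Rows are the tree's `LPRow` (qec-type-02's `Census/CSSLPCertificate.lean`, `β`-block unused), so infeasibility certificates are
checked by the EXISTING `farkasCheck` / `not_lpFeasible_of_farkasCheck` (exact rationals, `decide +kernel`). Consequence here:
`false_of_farkasCheck` (matrix form, split-weight hypotheses); the bridge from `(A, s)` / from a CSS code (`normalForm_false_of_certs`,
`css_false_of_certs`) is `Census/CSSK1SplitLPSound.lean`.
HONEST FRAMING: a linear-programming RELAXATION — infeasibility refutes, feasibility proves nothing (at `n = 16`, `d = 5` it is
feasible exactly at `(b, w) ∈ {(8,5), (8,7)}` and their `X ↔ Z` mirrors, see `Census/CSS/K1LP16.lean`). No distance is computed here.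
Variable index `r = (i(w+1) + j)(c+1) + l` (`enc`; decoders `di`/`dj`/`dl`). [folklore] throughout (weak LP duality; MacWilliams).
-/

namespace Summit.Ventures.QEC.Census.CSSK1LP

open Finset Matrix Literature.InformationTheory.Coding Literature.InformationTheory.QuantumCodes

/-! ## 3. The linear system of the `k = 1` CSS normal form and its feasibility -/

section LP

/-- Index of the split type `(i, j, l)`: `(i·(w+1) + j)·(c+1) + l`. [folklore] -/
def enc (w c : ℕ) (t : ℕ × ℕ × ℕ) : ℕ := (t.1 * (w + 1) + t.2.1) * (c + 1) + t.2.2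

/-- First component of the decoded index. [folklore] -/
def di (w c r : ℕ) : ℕ := r / (c + 1) / (w + 1)

/-- Second component of the decoded index. [folklore] -/
def dj (w c r : ℕ) : ℕ := r / (c + 1) % (w + 1)

/-- Third component of the decoded index. [folklore] -/
def dl (_w c r : ℕ) : ℕ := r % (c + 1)

/-- Decoding the third component. [folklore] -/
theorem dl_enc (w c : ℕ) {t : ℕ × ℕ × ℕ} (hl : t.2.2 ≤ c) : dl w c (enc w c t) = t.2.2 := by
  unfold dl enc
  rw [Nat.mul_add_mod_of_lt (by omega)]

/-- `enc t / (c+1) = i·(w+1) + j`. [folklore] -/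
theorem div_enc (w c : ℕ) {t : ℕ × ℕ × ℕ} (hl : t.2.2 ≤ c) : enc w c t / (c + 1) = t.1 * (w + 1) + t.2.1 := by
  unfold enc
  rw [show (t.1 * (w + 1) + t.2.1) * (c + 1) + t.2.2 = (c + 1) * (t.1 * (w + 1) + t.2.1) + t.2.2 by ring,
    Nat.mul_add_div (by omega), Nat.div_eq_of_lt (by omega), add_zero]

/-- Decoding the second component. [folklore] -/
theorem dj_enc (w c : ℕ) {t : ℕ × ℕ × ℕ} (hj : t.2.1 ≤ w) (hl : t.2.2 ≤ c) : dj w c (enc w c t) = t.2.1 := by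
  unfold dj
  rw [div_enc w c hl, Nat.mul_add_mod_of_lt (by omega)]

/-- Decoding the first component. [folklore] -/
theorem di_enc (w c : ℕ) {t : ℕ × ℕ × ℕ} (hj : t.2.1 ≤ w) (hl : t.2.2 ≤ c) : di w c (enc w c t) = t.1 := by
  unfold di
  rw [div_enc w c hl, show t.1 * (w + 1) + t.2.1 = (w + 1) * t.1 + t.2.1 by ring,
    Nat.mul_add_div (by omega), Nat.div_eq_of_lt (by omega), add_zero]

/-- A type in range has index `< (b+1)(w+1)(c+1)`. [folklore] -/
theorem enc_lt (b w c : ℕ) {t : ℕ × ℕ × ℕ} (hi : t.1 ≤ b) (hj : t.2.1 ≤ w) (hl : t.2.2 ≤ c) :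
    enc w c t < (b + 1) * (w + 1) * (c + 1) := by
  unfold enc
  have h1 : t.1 * (w + 1) + t.2.1 < (b + 1) * (w + 1) := by nlinarith
  have h2 : (t.1 * (w + 1) + t.2.1) * (c + 1) + t.2.2 < (t.1 * (w + 1) + t.2.1 + 1) * (c + 1) := by nlinarith
  have h3 : (t.1 * (w + 1) + t.2.1 + 1) * (c + 1) ≤ (b + 1) * (w + 1) * (c + 1) := Nat.mul_le_mul_right _ h1
  omega

/-- `dec ∘ enc = id` on types in range. [folklore] -/
theorem dec_enc (w c : ℕ) {t : ℕ × ℕ × ℕ} (hj : t.2.1 ≤ w) (hl : t.2.2 ≤ c) :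
    (di w c (enc w c t), dj w c (enc w c t), dl w c (enc w c t)) = t := by
  rw [di_enc w c hj hl, dj_enc w c hj hl, dl_enc w c hl]

/-- All split types `(i, j, l)` with `i ≤ b`, `j ≤ w`, `l ≤ c`. [folklore] -/
def triples (b w c : ℕ) : List (ℕ × ℕ × ℕ) :=
  (List.range (b + 1)).flatMap fun i => (List.range (w + 1)).flatMap fun j => (List.range (c + 1)).map fun l => (i, j, l)

/-- The split types EXCLUDED for the code `B = {(v, vP)}`: `v = 0` has type `(0,0,0)`; and `(Z)` at distance `d`: a `Z`-logical
`(v, vP + 1_S)` of type `(i, j, l)` has weight `i + (w − j) + l ≥ d`. [folklore] -/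
def zeroTriples (b w c d : ℕ) : List (ℕ × ℕ × ℕ) :=
  (triples b w c).filter fun t => (t.1 = 0 ∧ t ≠ (0, 0, 0)) ∨ (1 ≤ t.1 ∧ t.1 + (w - t.2.1) + t.2.2 + 1 ≤ d)

/-- The row `α_r = v`. [folklore] -/
def rowUnit (r : ℕ) (v : ℚ) : LPRow := ⟨fun r' => if r' = r then 1 else 0, fun _ => 0, v, true⟩

/-- The row `Σ_{j,l} α_{(i,j,l)} = C(b, i)` (the information block of `{(v, vP)}` carries every `v` exactly once). [folklore] -/
def rowP1 (b w c i : ℕ) : LPRow := ⟨fun r' => if di w c r' = i then 1 else 0, fun _ => 0, (b.choose i : ℚ), true⟩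

/-- The product of the three Krawtchouk numbers `K_i(i'; b) K_j(j'; w) K_l(l'; c)`. [folklore] -/
def kprodQ (b w c : ℕ) (t : ℕ × ℕ × ℕ) (i' j' l' : ℕ) : ℚ :=
  ((krawtchouk b t.1 i' * (krawtchouk w t.2.1 j' * krawtchouk c t.2.2 l') : ℤ) : ℚ)

/-- The `(X)`-exclusion at distance `d`: a dual type `(i, j, l)` with `j` odd is an `X`-logical of weight `i + j + l ≥ d`. [folklore] -/
def xcCond (d : ℕ) (t : ℕ × ℕ × ℕ) : Bool := decide (t.2.1 % 2 = 1 ∧ t.1 + t.2.1 + t.2.2 + 1 ≤ d)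

/-- The split-MacWilliams row of dual type `t = (i,j,l)`: `Σ_{r'} K_i K_j K_l(dec r') α_{r'} = 2^b A'_t ≥ 0`, and `= 0` when `t` is
`(X)`-excluded. [folklore] -/
def rowMW (b w c d : ℕ) (t : ℕ × ℕ × ℕ) : LPRow :=
  ⟨fun r' => kprodQ b w c t (di w c r') (dj w c r') (dl w c r'), fun _ => 0, 0, xcCond d t⟩

/-- **The `k = 1` CSS split linear system** at `(b, w, c, d)` with the split-MacWilliams rows listed in `mw`:
`α_{(0,0,0)} = 1`, the excluded types `= 0`, the information-block rows, and the chosen dual rows. [folklore] -/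
def k1Rows (b w c d : ℕ) (mw : List (ℕ × ℕ × ℕ)) : List LPRow :=
  rowUnit (enc w c (0, 0, 0)) 1 ::
    (((zeroTriples b w c d).map fun t => rowUnit (enc w c t) 0) ++
      (((List.range b).map fun i => rowP1 b w c (i + 1)) ++ (mw.map fun t => rowMW b w c d t)))

/-- The number of LP variables minus one. [folklore] -/
def k1N (b w c : ℕ) : ℕ := (b + 1) * (w + 1) * (c + 1) - 1

variable {κ μ : Type*} [Fintype κ] [Fintype μ] [DecidableEq κ] [DecidableEq μ]

/-- The split type `(wt v, wt_S(vP), wt_{Sᶜ}(vP))` of an information word. [folklore] -/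
def typeA (P : Matrix κ μ (ZMod 2)) (S : Finset μ) (v : κ → ZMod 2) : ℕ × ℕ × ℕ :=
  (wtOn univ v, wtOn S (v ᵥ* P), wtOn Sᶜ (v ᵥ* P))

/-- The LP point of `(P, S)`: `α_r = #{v : enc (type v) = r}` (the split weight distribution of `{(v, vP)}`). [folklore] -/
noncomputable def alphaOf (P : Matrix κ μ (ZMod 2)) (S : Finset μ) (r : ℕ) : ℚ :=
  #((univ : Finset (κ → ZMod 2)).filter fun v => enc #S #Sᶜ (typeA P S v) = r)

omit [DecidableEq κ] in
/-- The split type of `v` is in range. [folklore] -/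
theorem typeA_le (P : Matrix κ μ (ZMod 2)) (S : Finset μ) (v : κ → ZMod 2) :
    (typeA P S v).1 ≤ Fintype.card κ ∧ (typeA P S v).2.1 ≤ #S ∧ (typeA P S v).2.2 ≤ #Sᶜ :=
  ⟨(card_filter_le _ _).trans (card_univ (α := κ)).le, card_filter_le _ _, card_filter_le _ _⟩

/-- Evaluating a linear form on the LP point: `Σ_{r'} g(r') α_{r'} = Σ_v g(enc (type v))`. [folklore] -/
theorem sum_mul_alphaOf (P : Matrix κ μ (ZMod 2)) (S : Finset μ) (g : ℕ → ℚ) :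
    ∑ r ∈ range (k1N (Fintype.card κ) #S #Sᶜ + 1), g r * alphaOf P S r = ∑ v : κ → ZMod 2, g (enc #S #Sᶜ (typeA P S v)) := by
  have hM : k1N (Fintype.card κ) #S #Sᶜ + 1 = (Fintype.card κ + 1) * (#S + 1) * (#Sᶜ + 1) := by
    unfold k1N
    have : 1 ≤ (Fintype.card κ + 1) * (#S + 1) * (#Sᶜ + 1) := Nat.one_le_iff_ne_zero.mpr (by positivity)
    omega
  rw [hM]
  have hmaps : ∀ v ∈ (univ : Finset (κ → ZMod 2)),
      enc #S #Sᶜ (typeA P S v) ∈ range ((Fintype.card κ + 1) * (#S + 1) * (#Sᶜ + 1)) := fun v _ => by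
    rw [mem_range]
    obtain ⟨h1, h2, h3⟩ := typeA_le P S v
    exact enc_lt _ _ _ h1 h2 h3
  rw [← Finset.sum_fiberwise_of_maps_to hmaps]
  refine Finset.sum_congr rfl fun r _ => ?_
  rw [alphaOf, Finset.sum_congr rfl fun v hv => by rw [(Finset.mem_filter.mp hv).2], Finset.sum_const, nsmul_eq_mul,
    mul_comm]

/-- `α_{enc t} = #{v : type v = t}` for a type in range. [folklore] -/
theorem alphaOf_enc (P : Matrix κ μ (ZMod 2)) (S : Finset μ) {t : ℕ × ℕ × ℕ} (hj : t.2.1 ≤ #S) (hl : t.2.2 ≤ #Sᶜ) :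
    alphaOf P S (enc #S #Sᶜ t) = #((univ : Finset (κ → ZMod 2)).filter fun v => typeA P S v = t) := by
  unfold alphaOf
  congr 2
  ext v
  simp only [Finset.mem_filter, Finset.mem_univ, true_and]
  constructor
  · intro h
    obtain ⟨_, h2, h3⟩ := typeA_le P S v
    rw [← dec_enc #S #Sᶜ h2 h3, h, dec_enc #S #Sᶜ hj hl]
  · intro h
    rw [h]

omit [DecidableEq κ] in
/-- `wt v = 0 ↔ v = 0`. [folklore] -/
theorem wtOn_univ_eq_zero_iff (v : κ → ZMod 2) : wtOn univ v = 0 ↔ v = 0 := by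
  unfold wtOn
  rw [Finset.card_eq_zero, Finset.filter_eq_empty_iff]
  constructor
  · intro h
    funext q
    simpa using h (Finset.mem_univ q)
  · intro h q _
    simp [h]

omit [Fintype μ] [DecidableEq μ] in
/-- `wt_R(0) = 0`. [folklore] -/
@[simp] theorem wtOn_zero (R : Finset μ) : wtOn R (0 : μ → ZMod 2) = 0 := by
  simp [wtOn]

omit [Fintype κ] [DecidableEq κ] in
/-- `wt(u) = wt_S(u) + wt_{Sᶜ}(u)`. [folklore] -/
theorem wtOn_univ_eq_add (S : Finset μ) (u : μ → ZMod 2) : wtOn univ u = wtOn S u + wtOn Sᶜ u := by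
  unfold wtOn
  rw [← Finset.card_union_of_disjoint (Finset.disjoint_filter_filter (disjoint_compl_right (a := S))),
    ← Finset.filter_union, Finset.union_compl]

/-- **Feasibility.** If `(P, S)` satisfies `(Z)` and `(X)` at distance `d` (in split-weight form) then its split weight
distribution is a feasible point of `k1Rows`. [folklore] -/
theorem lpFeasible_k1Rows (P : Matrix κ μ (ZMod 2)) (S : Finset μ) (d : ℕ)
    (hZ : ∀ v : κ → ZMod 2, d ≤ wtOn univ v + (#S - wtOn S (v ᵥ* P)) + wtOn Sᶜ (v ᵥ* P))
    (hX : ∀ u : μ → ZMod 2, wtOn S u % 2 = 1 → d ≤ wtOn univ u + wtOn univ (P *ᵥ u))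
    (mw : List (ℕ × ℕ × ℕ)) :
    LPFeasible (k1Rows (Fintype.card κ) #S #Sᶜ d mw) (k1N (Fintype.card κ) #S #Sᶜ) (alphaOf P S) (fun _ => 0) := by
  classical
  refine ⟨fun r => by unfold alphaOf; positivity, fun _ => le_rfl, ?_⟩
  intro row hrow
  simp only [k1Rows, List.mem_cons, List.mem_append, List.mem_map] at hrow
  -- the evaluation of a row with `cB = 0`
  have hev : ∀ (cA : ℕ → ℚ) (rhs : ℚ) (e : Bool),
      (⟨cA, fun _ => 0, rhs, e⟩ : LPRow).eval (k1N (Fintype.card κ) #S #Sᶜ) (alphaOf P S) (fun _ => 0) =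
        ∑ v : κ → ZMod 2, cA (enc #S #Sᶜ (typeA P S v)) := by
    intro cA rhs e
    rw [LPRow.eval, ← sum_mul_alphaOf P S cA]
    simp
  rcases hrow with rfl | ⟨t, ht, rfl⟩ | ⟨i, hi, rfl⟩ | ⟨t, ht, rfl⟩
  · -- α_{(0,0,0)} = 1
    refine ⟨fun _ => ?_, fun h => by simp [rowUnit] at h⟩
    rw [rowUnit, hev]
    simp only
    have : ∀ v : κ → ZMod 2, (if enc #S #Sᶜ (typeA P S v) = enc #S #Sᶜ (0, 0, 0) then (1 : ℚ) else 0) =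
        if v = 0 then 1 else 0 := by
      intro v
      obtain ⟨_, h2, h3⟩ := typeA_le P S v
      have hiff : enc #S #Sᶜ (typeA P S v) = enc #S #Sᶜ (0, 0, 0) ↔ v = 0 := by
        constructor
        · intro h
          have := dec_enc #S #Sᶜ h2 h3
          rw [h, dec_enc #S #Sᶜ (by simp) (by simp)] at this
          have h0 : (typeA P S v).1 = 0 := by rw [← this]
          exact (wtOn_univ_eq_zero_iff v).mp h0
        · rintro rfl
          simp [typeA, Matrix.zero_vecMul]
      simp only [hiff]
    simp_rw [this]
    rw [Finset.sum_ite_eq']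
    simp
  · -- excluded types
    refine ⟨fun _ => ?_, fun h => by simp [rowUnit] at h⟩
    rw [rowUnit, hev]
    simp only
    have htmem := ht
    simp only [zeroTriples, triples, List.mem_filter, List.mem_flatMap, List.mem_map, List.mem_range,
      decide_eq_true_eq] at htmem
    obtain ⟨⟨i, hi, j, hj, l, hl, rfl⟩, hcond⟩ := htmem
    refine Finset.sum_eq_zero fun v _ => ?_
    rw [if_neg]
    intro h
    obtain ⟨_, h2, h3⟩ := typeA_le P S v
    have htv : typeA P S v = (i, j, l) := by
      rw [← dec_enc #S #Sᶜ h2 h3, h, dec_enc #S #Sᶜ (by simpa using Nat.lt_succ_iff.mp hj) (by simpa using Nat.lt_succ_iff.mp hl)]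
    rcases hcond with ⟨hi0, hne⟩ | ⟨hi1, hle⟩
    · simp only at hi0
      subst hi0
      have hv0 : v = 0 := (wtOn_univ_eq_zero_iff v).mp (by have := congrArg Prod.fst htv; simpa [typeA] using this)
      subst hv0
      apply hne
      simp [typeA, Matrix.zero_vecMul] at htv
      rw [← htv.1, ← htv.2]
    · have hz := hZ v
      simp only [typeA, Prod.mk.injEq] at htv
      obtain ⟨h1, h2', h3'⟩ := htv
      rw [h1, h2', h3'] at hz
      simp only at hi1 hle
      omega
  · -- information-block rows
    refine ⟨fun _ => ?_, fun h => by simp [rowP1] at h⟩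
    rw [rowP1, hev]
    simp only
    have : ∀ v : κ → ZMod 2, (if di #S #Sᶜ (enc #S #Sᶜ (typeA P S v)) = i + 1 then (1 : ℚ) else 0) =
        if hammingNorm v = i + 1 then 1 else 0 := by
      intro v
      obtain ⟨_, h2, h3⟩ := typeA_le P S v
      rw [di_enc #S #Sᶜ h2 h3]
      rfl
    simp_rw [this]
    rw [Finset.sum_boole, PerfectCode.card_filter_hammingNorm_eq]
  · -- split-MacWilliams rows
    have hevt : (rowMW (Fintype.card κ) #S #Sᶜ d t).eval (k1N (Fintype.card κ) #S #Sᶜ) (alphaOf P S) (fun _ => 0) =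
        (2 : ℚ) ^ Fintype.card κ *
          #((univ : Finset (μ → ZMod 2)).filter fun u =>
              wtOn univ (P *ᵥ u) = t.1 ∧ wtOn S u = t.2.1 ∧ wtOn Sᶜ u = t.2.2) := by
      rw [rowMW, hev]
      have : ∀ v : κ → ZMod 2, kprodQ (Fintype.card κ) #S #Sᶜ t (di #S #Sᶜ (enc #S #Sᶜ (typeA P S v)))
          (dj #S #Sᶜ (enc #S #Sᶜ (typeA P S v))) (dl #S #Sᶜ (enc #S #Sᶜ (typeA P S v))) =
            (kprod P S t.1 t.2.1 t.2.2 v : ℚ) := by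
        intro v
        obtain ⟨_, h2, h3⟩ := typeA_le P S v
        rw [di_enc #S #Sᶜ h2 h3, dj_enc #S #Sᶜ h2 h3, dl_enc #S #Sᶜ h3]
        rfl
      simp_rw [this]
      rw [← Int.cast_sum, sum_kprod_eq]
      push_cast
      ring
    refine ⟨fun heq => ?_, fun _ => ?_⟩
    · -- (X)-excluded dual type: no `u` of that type
      rw [hevt]
      simp only [rowMW]
      have hx : xcCond d t = true := heq
      simp only [xcCond, decide_eq_true_eq] at hx
      rw [Finset.card_eq_zero.mpr, Nat.cast_zero, mul_zero]
      refine Finset.filter_eq_empty_iff.mpr fun u _ ⟨h1, h2, h3⟩ => ?_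
      have := hX u (by rw [h2]; exact hx.1)
      rw [wtOn_univ_eq_add S u, h1, h2, h3] at this
      omega
    · rw [hevt]
      simp only [rowMW]
      positivity

/-- **Infeasibility certificate ⇒ no normal form.** [folklore] -/
theorem false_of_farkasCheck (P : Matrix κ μ (ZMod 2)) (S : Finset μ) {b w c d : ℕ} {mw : List (ℕ × ℕ × ℕ)} {ys : List ℚ}
    (hc : farkasCheck (k1Rows b w c d mw) ys (k1N b w c) = true)
    (hb : Fintype.card κ = b) (hw : #S = w) (hcc : #Sᶜ = c)
    (hZ : ∀ v : κ → ZMod 2, d ≤ wtOn univ v + (#S - wtOn S (v ᵥ* P)) + wtOn Sᶜ (v ᵥ* P))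
    (hX : ∀ u : μ → ZMod 2, wtOn S u % 2 = 1 → d ≤ wtOn univ u + wtOn univ (P *ᵥ u)) : False := by
  subst hb hw hcc
  exact not_lpFeasible_of_farkasCheck hc (lpFeasible_k1Rows P S d hZ hX mw)

end LP

end Summit.Ventures.QEC.Census.CSSK1LP
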